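/-
Copyright (c) 2026 the pub-hodgecm-mathlib formalisation cell (harness21).  Prover seat hodgecm-mathlib-K2E4-p07 (g0),
Track B «K2-LIT» ∕ h413, unit «FinGermConstants» of the line `K2_E4_SingularTransferKappaSign`, socket #7
`K2E4SingularTransferKappaSign.FinGermConstants.sig_K2E3GermConstantRegularH` (ED. 2 name; ED. 1 `sig_K2E4FinSingularTransferValueNonvanishing`):
THE UNIT PAIR `(1_{K_{H,v}}, 1_{K_v})` CHARGES THE CENTRAL POINT `γ_{H,v}` AT EVERY GOOD PLACE — the part of the socket its own binders pay for.  2026-09-03.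
-/
import Literature.NumberTheory.Rogawski1990.TamagawaSingularMembersFinTFCovol     -- ★ p844690: the letters' FRAME (`CanonicalTransferMatrix`, `ArchCanonicalSingularMatrix`, binders byte-for-byte)
import Literature.NumberTheory.Rogawski1990.LocalTransferFundamentalLemma          -- ★ `isLocSmooth_indicator_subgroup`
import Literature.NumberTheory.Automorphic.LocalUnitaryIntegralLevel               -- ★ `isCompact_isOpen_cmLocalIntegralLevel`
import Literature.NumberTheory.Automorphic.LocalUnitaryGroupCongr                  -- ★ `antidiagOne_isHermitian`, `isUnit_antidiagOne_det`
import Literature.NumberTheory.Automorphic.ResiduallySeparableAlmostEverywhere     -- ★ `eventually_toLocal_toAdelic_mem_cmLocalIntegralLevel`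
import Literature.NumberTheory.Automorphic.CMPrincipalSeriesSpherical              -- ★ `mem_cmLocalIntegralLevel_iff_forall_v_le_one`
import Literature.NumberTheory.Automorphic.UnitOrbitalIntegralFixedPointsPair      -- ★ `cmLocalIntegralLevel_one_eq_top_of_smul_eq`
import Literature.NumberTheory.Automorphic.GaloisActionPlaces                     -- ★ `HeightOneSpectrum.valuation_algEquiv_smul`
import Literature.NumberTheory.Rogawski1990.AdelicStableOrbitalCentralH            -- ★ `coe_coe_cmDatum_toLocal_toAdelic_eq_smul_one_of_smul_one`
import Literature.NumberTheory.Rogawski1990.ExplicitFactorKappaAlmostEverywhereOne -- ★ `smul_placesOver_eq_of_subsingleton`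
import HarnessLib

/-!
# K2_E4 road (h413 = stmt-HodgeConjecture-24833), unit «FinGermConstants», socket #7 `sig_K2E3GermConstantRegularH` — what its binders pay:
# at every place `v ∉ S_bad` with `γ_{H,v} ∈ K_{H,v}` the UNIT PAIR `(1_{K_{H,v}}, 1_{K_v})` is a smooth `Δ_v`-transfer pair charging `γ_{H,v}`

Cell `pub/hodgecm-mathlib` (D-0151), Track B (21-frontier RULING «PUSH BOTH» 2026-09-03, director req621∕req624, chair K2-lead ORDER #1 §4.4 ∕
ORDER #2, RULING R4 (a)), socket module `Summits/HodgeConjecture/HodgeConjecture/Cruxes/H413/Lines/K2_E4_SingularTransferKappaSignSigsFinGermConstants.lean`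
(planner K2E4-plan (g0), ED. 2 95b740eb89190ebf; OWNER of the socket: K2E3), socket **`sig_K2E3GermConstantRegularH`** (#7, «SOME smooth transfer pair
charges `γ_{H,v}`»): under the letters' frame and `hCTM : CanonicalTransferMatrix L H′ Tinf.Δ νH νG Sbad Δ mH mG`, for the singular pair
(`γ₀` with `(γ₀ − e₁)(γ₀ − e₂) = 0`, `e₁ ≠ e₂`; `γ_H = (e₁·1₂, e₂)`) and EVERY finite place `v`, some smooth `(f^H, f)` with
`IsLocalDeltaTransfer L H′ v (Δ v) (mH v) (mG v) f^H f` has `f^H(γ_{H,v}) ≠ 0`.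

THE MATHEMATICS (what this file proves, and what it cannot).  The datum `Δ` of the socket is ABSTRACT: `hCTM` hands, at a place `v`, the local transfer
datum (★ `IsLocalTransferDatum`: `Δ_v` non-degenerate on the `G`-regular matching pairs, admissible ∕ canonical measure families, a smooth `Δ_v`-transfer of every
smooth `f`) and, when `v ∉ S_bad`, the UNIT FUNDAMENTAL LEMMA ★ `IsLocalUnitTransfer`: `1_{U(Φ₂)(𝒪_v) × U(Φ₁)(𝒪_v)}` is a `Δ_v`-transfer of `1_{U(H′)(𝒪_v)}`
[Rogawski1990, Prop. 4.9.1 (b) p. 55].  Both indicators are locally constant with compact support (★ `isLocSmooth_indicator_subgroup`, ★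
`isCompact_isOpen_cmLocalIntegralLevel`), so at `v ∉ S_bad` the unit pair is a smooth transfer pair, and it charges `γ_{H,v}` exactly when
`γ_{H,v} ∈ K_{H,v} = U(Φ₂)(𝒪_v) × U(Φ₁)(𝒪_v)` — which holds at all but finitely many `v` for the rational `γ_H` (★ `eventually_toLocal_toAdelic_mem_cmLocalIntegralLevel`,
[PlatonovRapinchuk1994, §5.1]) and at EVERY non-split `v` (a scalar unitary `e·1` has `ē e = 1`, so `e` is a `w`-unit at the conjugation-fixed place `w ∣ v`).  This is §1–§3 below.  At `v ∈ S_bad` the socket's binders give nothing but `IsLocalTransferDatum` for an abstract factor `Δ_v`;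
the value at the non-`G`-regular central point `γ_{H,v}` of an abstractly given transfer is then governed by the germ expansion of stable orbital integrals of
`H_v` about `γ_{H,v}` [Rogawski1990, Prop. 8.1.3 p. 116] TOGETHER WITH the behaviour of `Δ_v` at the singular pair, which print controls only for the
Langlands–Shelstad ∕ explicit factor [Rogawski1990, Prop. 8.2.1 (a) p. 118; Lemma 4.13.1 (a) p. 70] — for abstract local transfer data this is the unit
«WeakMatrixRigidity» bridge (NOT IN PRINT).  That residue is reported on the squad bus (K2/STATUS.md, seat K2E4-p07), not claimed here.

* §1 `exists_transferPair_apply_ne_zero_of_isLocalUnitTransfer` — place-level: `IsLocalUnitTransfer` + `z_H ∈ K_{H,v}` ⇒ a smooth transfer pair charging `z_H`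
  (with `hCTM` this is the socket at every `v ∉ Sbad` with `γ_{H,v} ∈ K_{H,v}`: feed `(hCTM.1 v).2.1 ‹v ∉ Sbad›`).
* §2 `cmConj_mul_self_eq_one_of_coe_eq_smul_one`, `valuation_eq_one_of_cmConj_mul_self_eq_one`, `toLocal_toAdelic_mem_cmLocalIntegralLevel_of_coe_eq_smul_one` —
  a scalar `e • 1 ∈ U(H)(L)` has `ē e = 1`, hence is a unit at every conjugation-fixed place, hence `(e • 1)_v ∈ U(Φ_N)(𝒪_v)` at every non-split `v`.
* §3 **`germConstantRegularH_eventually`** — the socket's binders TOKEN FOR TOKEN, conclusion `∀ᶠ v in cofinite, ∃ (f^H, f) …`;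
  **`germConstantRegularH_of_subsingleton`** — the socket's binders TOKEN FOR TOKEN, conclusion `∀ v, v ∉ Sbad → Subsingleton (PlacesOver L v) → ∃ (f^H, f) …`
  (every NON-SPLIT good place — the places of STUB D of the tier-0 line).

HONEST LABEL: HC_CM is proved only modulo the 7 printed citations (2 remaining named inputs: hLiu418 = stmt-HodgeConjecture-24832, h413 =
stmt-HodgeConjecture-24833) until rung 0 closes; this file is a `--supports stmt-HodgeConjecture-24833` helper and retires nothing by itself; it does NOT pay
socket #7 (all `v`), only its good-place part.
-/

set_option autoImplicit false
set_option linter.dupNamespace false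

noncomputable section

open MeasureTheory Measure NumberField IsDedekindDomain
open Literature.MeasureTheory.Group Literature.MeasureTheory.RestrictedProduct
open Literature.Topology.RestrictedProduct Literature.Topology.Algebra.RestrictedProduct
open Literature.NumberTheory.Rogawski1990 Literature.NumberTheory.Automorphic
open Literature.AlgebraicGeometry.ShimuraVarieties (unitaryGroup hermForm)
open scoped Matrix MatrixGroups RestrictedProduct

namespace Summit.HodgeConjecture.HodgeConjecture.Cruxes.H413.K2E3GermConstantRegularHUnitPair

/-! ## §1  Place level: the unit pair charges every point of `K_{H,v}` -/

section Local

variable (L : Type) [Field L] [NumberField L] [IsCMField L] (H' : Matrix (Fin 3) (Fin 3) L)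
  (v : HeightOneSpectrum (𝓞 ↥(maximalRealSubfield L)))
  [∀ a : ((UnitaryGroup.cmDatum L 2 (Matrix.of fun i j : Fin 2 => if i.val + j.val + 1 = 2 then (1 : L) else 0)).Local v × (UnitaryGroup.cmDatum L 1 (Matrix.of fun i j : Fin 1 => if i.val + j.val + 1 = 1 then (1 : L) else 0)).Local v),
      MeasurableSpace (((UnitaryGroup.cmDatum L 2 (Matrix.of fun i j : Fin 2 => if i.val + j.val + 1 = 2 then (1 : L) else 0)).Local v × (UnitaryGroup.cmDatum L 1 (Matrix.of fun i j : Fin 1 => if i.val + j.val + 1 = 1 then (1 : L) else 0)).Local v) ⧸ Subgroup.centralizer ({a} : Set ((UnitaryGroup.cmDatum L 2 (Matrix.of fun i j : Fin 2 => if i.val + j.val + 1 = 2 then (1 : L) else 0)).Local v × (UnitaryGroup.cmDatum L 1 (Matrix.of fun i j : Fin 1 => if i.val + j.val + 1 = 1 then (1 : L) else 0)).Local v)))]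
  [∀ γ : (UnitaryGroup.cmDatum L 3 H').Local v,
      MeasurableSpace ((UnitaryGroup.cmDatum L 3 H').Local v ⧸ Subgroup.centralizer ({γ} : Set ((UnitaryGroup.cmDatum L 3 H').Local v)))]

/-- **The unit pair charges `K_{H,v}`.**  If `1_{K_{H,v}}` is a `Δ_v`-transfer of `1_{K_v}` (★ `IsLocalUnitTransfer`, the unit fundamental lemma at `v`
[Rogawski1990, Prop. 4.9.1 (b)]) then for every `z_H ∈ K_{H,v} = U(Φ₂)(𝒪_v) × U(Φ₁)(𝒪_v)` the pair `(1_{K_{H,v}}, 1_{K_v})` is a smooth (locally constant,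
compactly supported) `Δ_v`-transfer pair with `1_{K_{H,v}}(z_H) = 1 ≠ 0`. [cite: Rogawski1990, §4.9 Prop. 4.9.1 (b) p. 55; §1.6 p. 6] -/
theorem exists_transferPair_apply_ne_zero_of_isLocalUnitTransfer {T : LocalTransferFactor L H' v}
    {mH : OrbitalMeasureFamily ((UnitaryGroup.cmDatum L 2 (Matrix.of fun i j : Fin 2 => if i.val + j.val + 1 = 2 then (1 : L) else 0)).Local v × (UnitaryGroup.cmDatum L 1 (Matrix.of fun i j : Fin 1 => if i.val + j.val + 1 = 1 then (1 : L) else 0)).Local v)} {mG : OrbitalMeasureFamily ((UnitaryGroup.cmDatum L 3 H').Local v)}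
    (hunit : IsLocalUnitTransfer L H' v T mH mG) (zH : (UnitaryGroup.cmDatum L 2 (Matrix.of fun i j : Fin 2 => if i.val + j.val + 1 = 2 then (1 : L) else 0)).Local v × (UnitaryGroup.cmDatum L 1 (Matrix.of fun i j : Fin 1 => if i.val + j.val + 1 = 1 then (1 : L) else 0)).Local v)
    (hz : zH ∈ (UnitaryGroup.cmLocalIntegralLevel L 2 (Matrix.of fun i j : Fin 2 => if i.val + j.val + 1 = 2 then (1 : L) else 0) v).prod (UnitaryGroup.cmLocalIntegralLevel L 1 (Matrix.of fun i j : Fin 1 => if i.val + j.val + 1 = 1 then (1 : L) else 0) v)) :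
    ∃ (fH : (UnitaryGroup.cmDatum L 2 (Matrix.of fun i j : Fin 2 => if i.val + j.val + 1 = 2 then (1 : L) else 0)).Local v × (UnitaryGroup.cmDatum L 1 (Matrix.of fun i j : Fin 1 => if i.val + j.val + 1 = 1 then (1 : L) else 0)).Local v → ℂ) (f : (UnitaryGroup.cmDatum L 3 H').Local v → ℂ),
      IsLocSmooth f ∧ IsLocSmooth fH ∧ IsLocalDeltaTransfer L H' v T mH mG fH f ∧ fH zH ≠ 0 := by
  obtain ⟨hKc, hKo⟩ := UnitaryGroup.isCompact_isOpen_cmLocalIntegralLevel L 3 H' v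
  obtain ⟨hK₂c, hK₂o⟩ := UnitaryGroup.isCompact_isOpen_cmLocalIntegralLevel L 2 (Matrix.of fun i j : Fin 2 => if i.val + j.val + 1 = 2 then (1 : L) else 0) v
  obtain ⟨hK₁c, hK₁o⟩ := UnitaryGroup.isCompact_isOpen_cmLocalIntegralLevel L 1 (Matrix.of fun i j : Fin 1 => if i.val + j.val + 1 = 1 then (1 : L) else 0) v
  have hprod : (((UnitaryGroup.cmLocalIntegralLevel L 2 (Matrix.of fun i j : Fin 2 => if i.val + j.val + 1 = 2 then (1 : L) else 0) v).prod (UnitaryGroup.cmLocalIntegralLevel L 1 (Matrix.of fun i j : Fin 1 => if i.val + j.val + 1 = 1 then (1 : L) else 0) v) :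
      Subgroup ((UnitaryGroup.cmDatum L 2 (Matrix.of fun i j : Fin 2 => if i.val + j.val + 1 = 2 then (1 : L) else 0)).Local v × (UnitaryGroup.cmDatum L 1 (Matrix.of fun i j : Fin 1 => if i.val + j.val + 1 = 1 then (1 : L) else 0)).Local v)) : Set ((UnitaryGroup.cmDatum L 2 (Matrix.of fun i j : Fin 2 => if i.val + j.val + 1 = 2 then (1 : L) else 0)).Local v × (UnitaryGroup.cmDatum L 1 (Matrix.of fun i j : Fin 1 => if i.val + j.val + 1 = 1 then (1 : L) else 0)).Local v)) =
      (UnitaryGroup.cmLocalIntegralLevel L 2 (Matrix.of fun i j : Fin 2 => if i.val + j.val + 1 = 2 then (1 : L) else 0) v : Set ((UnitaryGroup.cmDatum L 2 (Matrix.of fun i j : Fin 2 => if i.val + j.val + 1 = 2 then (1 : L) else 0)).Local v)) ×ˢ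
        (UnitaryGroup.cmLocalIntegralLevel L 1 (Matrix.of fun i j : Fin 1 => if i.val + j.val + 1 = 1 then (1 : L) else 0) v : Set ((UnitaryGroup.cmDatum L 1 (Matrix.of fun i j : Fin 1 => if i.val + j.val + 1 = 1 then (1 : L) else 0)).Local v)) :=
    Subgroup.coe_prod _ _
  refine ⟨_, _, isLocSmooth_indicator_subgroup _ hKo hKc, isLocSmooth_indicator_subgroup _ ?_ ?_, hunit, ?_⟩
  · rw [hprod]; exact hK₂o.prod hK₁o
  · rw [hprod]; exact hK₂c.prod hK₁c
  · rw [Set.indicator_of_mem (show zH ∈ ((((UnitaryGroup.cmLocalIntegralLevel L 2 (Matrix.of fun i j : Fin 2 => if i.val + j.val + 1 = 2 then (1 : L) else 0) v).prod (UnitaryGroup.cmLocalIntegralLevel L 1 (Matrix.of fun i j : Fin 1 => if i.val + j.val + 1 = 1 then (1 : L) else 0) v) :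
      Subgroup ((UnitaryGroup.cmDatum L 2 (Matrix.of fun i j : Fin 2 => if i.val + j.val + 1 = 2 then (1 : L) else 0)).Local v × (UnitaryGroup.cmDatum L 1 (Matrix.of fun i j : Fin 1 => if i.val + j.val + 1 = 1 then (1 : L) else 0)).Local v)) : Set ((UnitaryGroup.cmDatum L 2 (Matrix.of fun i j : Fin 2 => if i.val + j.val + 1 = 2 then (1 : L) else 0)).Local v × (UnitaryGroup.cmDatum L 1 (Matrix.of fun i j : Fin 1 => if i.val + j.val + 1 = 1 then (1 : L) else 0)).Local v))) from hz)]
    exact one_ne_zero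

end Local

/-! ## §2  Non-split places: a scalar unitary element is integral (so §1 applies at EVERY non-split `v ∉ S_bad`) -/

section Nonsplit

variable (L : Type) [Field L] [NumberField L] [IsCMField L]

/-- `(r • 1).map f = f r • 1` for a ring map `f`. [folklore] -/
private theorem smul_one_map {R S : Type*} [CommRing R] [CommRing S] {n : Type*} [DecidableEq n] [Fintype n] (f : R →+* S) (r : R) :
    (r • (1 : Matrix n n R)).map f = f r • (1 : Matrix n n S) := by
  ext i j
  simp only [Matrix.map_apply, Matrix.smul_apply, Matrix.one_apply, smul_eq_mul, mul_ite, mul_one, mul_zero]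
  split_ifs <;> simp

/-- **A scalar `e • 1 ∈ U(H)(L)` has `ē·e = 1`** as soon as `H` has a non-zero entry: `ᵗ(ē•1)·H·(e•1) = (ē e)•H = H`.
[cite: Rogawski1990, §1.9 p. 8] -/
theorem cmConj_mul_self_eq_one_of_coe_eq_smul_one {N : ℕ} {H : Matrix (Fin N) (Fin N) L} (i j : Fin N) (hHij : H i j ≠ 0)
    {γ : (UnitaryGroup.cmDatum L N H).Rational} {e : L}
    (hγ : (((γ : unitaryGroup (cmConjRingHom L) H).val : GL (Fin N) L) : Matrix (Fin N) (Fin N) L) = e • (1 : Matrix (Fin N) (Fin N) L)) :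
    cmConjRingHom L e * e = 1 := by
  have hmem := Literature.AlgebraicGeometry.ShimuraVarieties.mem_unitaryGroup_iff.1 (γ : unitaryGroup (cmConjRingHom L) H).2
  rw [hγ, smul_one_map, Matrix.transpose_smul, Matrix.transpose_one, Matrix.smul_mul, Matrix.one_mul, Matrix.mul_smul,
    Matrix.mul_one, smul_smul] at hmem
  have hij := congrFun (congrFun hmem i) j
  rw [Matrix.smul_apply, smul_eq_mul] at hij
  have h1 := mul_right_cancel₀ hHij (hij.trans (one_mul _).symm)
  simpa [mul_comm] using h1

/-- **Norm-one elements are units at a conjugation-fixed place**: `ē·e = 1` and `c • w = w` give `v_w(e) = 1` (`v_w(ē) = v_{c•w}(c e) = v_w(e)`,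
★ `HeightOneSpectrum.valuation_algEquiv_smul`). [cite: CasselsFrohlichANT1967, Ch. VII §1.1] [cite: PlatonovRapinchuk1994, §5.1] -/
theorem valuation_eq_one_of_cmConj_mul_self_eq_one (w : HeightOneSpectrum (𝓞 L)) (hw : IsCMField.complexConj L • w = w) {e : L}
    (he : cmConjRingHom L e * e = 1) : w.valuation L e = 1 := by
  have hσ : w.valuation L (cmConjRingHom L e) = w.valuation L e := by
    have h := HeightOneSpectrum.valuation_algEquiv_smul (σ := IsCMField.complexConj L) (w := w) (x := e)
    rw [hw] at h
    rw [cmConjRingHom_apply]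
    exact h
  have hsq : w.valuation L e * w.valuation L e = 1 := by
    have := congrArg (w.valuation L) he
    rwa [map_mul, map_one, hσ] at this
  rcases lt_trichotomy (w.valuation L e) 1 with h | h | h
  · exact absurd hsq (lt_of_le_of_lt ((mul_le_mul' le_rfl h.le).trans_eq (mul_one _)) h).ne
  · exact h
  · exact absurd hsq (lt_of_lt_of_le h ((mul_one _).symm.trans_le (mul_le_mul' le_rfl h.le))).ne'

/-- **A scalar rational element of `U(Φ_N)(L⁺)` with `ē·e = 1` lies in `U(Φ_N)(𝒪_v)` at every NON-SPLIT `v`** (one place above `v`): its local component is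
`(e ⊗ 1) • 1` (★ `coe_coe_cmDatum_toLocal_toAdelic_eq_smul_one_of_smul_one`), whose entries `e`, `0` (and `ē`, `0` for the inverse) have valuation `≤ 1` at
the `c`-fixed place `w ∣ v` (★ `mem_cmLocalIntegralLevel_iff_forall_v_le_one`). [cite: PlatonovRapinchuk1994, §5.1] -/
theorem toLocal_toAdelic_mem_cmLocalIntegralLevel_of_coe_eq_smul_one {N : ℕ} (v : HeightOneSpectrum (𝓞 ↥(maximalRealSubfield L)))
    (hv : Subsingleton (UnitaryGroup.PlacesOver L v)) {γ : (UnitaryGroup.cmDatum L N (Matrix.of fun i j : Fin N => if i.val + j.val + 1 = N then (1 : L) else 0)).Rational} {e : L}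
    (hγ : (((γ : unitaryGroup (cmConjRingHom L) (Matrix.of fun i j : Fin N => if i.val + j.val + 1 = N then (1 : L) else 0)).val : GL (Fin N) L) : Matrix (Fin N) (Fin N) L) = e • (1 : Matrix (Fin N) (Fin N) L))
    (he : cmConjRingHom L e * e = 1) :
    (UnitaryGroup.cmDatum L N (Matrix.of fun i j : Fin N => if i.val + j.val + 1 = N then (1 : L) else 0)).toLocal v ((UnitaryGroup.cmDatum L N (Matrix.of fun i j : Fin N => if i.val + j.val + 1 = N then (1 : L) else 0)).toAdelic γ) ∈
      UnitaryGroup.cmLocalIntegralLevel L N (Matrix.of fun i j : Fin N => if i.val + j.val + 1 = N then (1 : L) else 0) v := by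
  haveI := hv
  have hval : ∀ w : UnitaryGroup.PlacesOver L v, w.1.valuation L e = 1 := fun w =>
    valuation_eq_one_of_cmConj_mul_self_eq_one L w.1 (smul_placesOver_eq_of_subsingleton L v (IsCMField.complexConj L) hv w) he
  have hval' : ∀ w : UnitaryGroup.PlacesOver L v, w.1.valuation L (cmConjRingHom L e) = 1 := fun w => by
    have h := congrArg (w.1.valuation L) he
    rw [map_mul, map_one, hval w, mul_one] at h
    exact h
  have he' : e * cmConjRingHom L e = 1 := by rw [mul_comm]; exact he
  -- the rational inverse is the scalar `ē • 1`
  have hγinv : ((((γ⁻¹ : (UnitaryGroup.cmDatum L N (Matrix.of fun i j : Fin N => if i.val + j.val + 1 = N then (1 : L) else 0)).Rational) : unitaryGroup (cmConjRingHom L) (Matrix.of fun i j : Fin N => if i.val + j.val + 1 = N then (1 : L) else 0)).val : GL (Fin N) L) :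
      Matrix (Fin N) (Fin N) L) = cmConjRingHom L e • (1 : Matrix (Fin N) (Fin N) L) := by
    change (((γ : unitaryGroup (cmConjRingHom L) (Matrix.of fun i j : Fin N => if i.val + j.val + 1 = N then (1 : L) else 0)).val⁻¹ : GL (Fin N) L) : Matrix (Fin N) (Fin N) L) = _
    refine Units.inv_eq_of_mul_eq_one_right ?_
    rw [hγ, Matrix.smul_mul, Matrix.one_mul, smul_smul, he', one_smul]
  -- local matrices of `γ_v` and `γ_v⁻¹`
  have hloc := coe_coe_cmDatum_toLocal_toAdelic_eq_smul_one_of_smul_one hγ v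
  have hloc' := coe_coe_cmDatum_toLocal_toAdelic_eq_smul_one_of_smul_one hγinv v
  rw [map_inv, map_inv] at hloc'
  refine (UnitaryGroup.mem_cmLocalIntegralLevel_iff_forall_v_le_one L N v _).2 ⟨fun i j w => ?_, fun i j w => ?_⟩
  · have h1 := congrFun (congrFun hloc i) j
    rw [Matrix.smul_apply, Matrix.one_apply, smul_eq_mul, mul_ite, mul_one, mul_zero] at h1
    rw [h1]
    split_ifs
    · exact le_of_eq ((HeightOneSpectrum.valuedAdicCompletion_eq_valuation' w.1 e).trans (hval w))
    · rw [Pi.zero_apply, map_zero]; exact zero_le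
  · have h1 := congrFun (congrFun hloc' i) j
    rw [Matrix.smul_apply, Matrix.one_apply, smul_eq_mul, mul_ite, mul_one, mul_zero] at h1
    have h2 : Valued.v ((if i = j then UnitaryGroup.adeleToLocal L v (algebraMap L (AdeleRing (𝓞 L) L) (cmConjRingHom L e)) else 0) w) ≤ 1 := by
      split_ifs
      · exact le_of_eq ((HeightOneSpectrum.valuedAdicCompletion_eq_valuation' w.1 (cmConjRingHom L e)).trans (hval' w))
      · rw [Pi.zero_apply, map_zero]; exact zero_le
    exact (congrArg (fun x : UnitaryGroup.LocalRing L v => Valued.v (x w)) h1).trans_le h2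

end Nonsplit

/-! ## §3  The socket's frame: almost every place, and every non-split good place -/

section Frame

variable (L : Type) [Field L] [NumberField L] [IsCMField L]

variable (H' : Matrix (Fin 3) (Fin 3) L) (Tinf : ArchTransferFactor L H')
    -- σ-algebras of the `G′` side (★ (O10-c5) block), of `H_v`, `G_∞`, `H_∞`, and the Haar data — EXACTLY ★ `SingularEllipticTransfer`'s binders
    [∀ γ : UnitaryGroup.arch (↥(maximalRealSubfield L)) L (IsCMField.complexConj L) 3 H',
      MeasurableSpace (UnitaryGroup.arch (↥(maximalRealSubfield L)) L (IsCMField.complexConj L) 3 H' ⧸ Subgroup.centralizer ({γ} : Set (UnitaryGroup.arch (↥(maximalRealSubfield L)) L (IsCMField.complexConj L) 3 H')))]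
    [∀ γ : UnitaryGroup.arch (↥(maximalRealSubfield L)) L (IsCMField.complexConj L) 3 H',
      BorelSpace (UnitaryGroup.arch (↥(maximalRealSubfield L)) L (IsCMField.complexConj L) 3 H' ⧸ Subgroup.centralizer ({γ} : Set (UnitaryGroup.arch (↥(maximalRealSubfield L)) L (IsCMField.complexConj L) 3 H')))]
    [∀ (v : HeightOneSpectrum (𝓞 ↥(maximalRealSubfield L))) (γ : (UnitaryGroup.cmDatum L 3 H').Local v),
      MeasurableSpace ((UnitaryGroup.cmDatum L 3 H').Local v ⧸ Subgroup.centralizer ({γ} : Set ((UnitaryGroup.cmDatum L 3 H').Local v)))]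
    [∀ (v : HeightOneSpectrum (𝓞 ↥(maximalRealSubfield L))) (γ : (UnitaryGroup.cmDatum L 3 H').Local v),
      BorelSpace ((UnitaryGroup.cmDatum L 3 H').Local v ⧸ Subgroup.centralizer ({γ} : Set ((UnitaryGroup.cmDatum L 3 H').Local v)))]
    [∀ v : HeightOneSpectrum (𝓞 ↥(maximalRealSubfield L)), MeasurableSpace ((UnitaryGroup.cmDatum L 3 H').Local v)] [∀ v : HeightOneSpectrum (𝓞 ↥(maximalRealSubfield L)), BorelSpace ((UnitaryGroup.cmDatum L 3 H').Local v)]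
    [MeasurableSpace (UnitaryGroup.arch (↥(maximalRealSubfield L)) L (IsCMField.complexConj L) 3 H')] [BorelSpace (UnitaryGroup.arch (↥(maximalRealSubfield L)) L (IsCMField.complexConj L) 3 H')]
    [∀ v : HeightOneSpectrum (𝓞 ↥(maximalRealSubfield L)), MeasurableSpace ((UnitaryGroup.cmDatum L 2 (Matrix.of fun i j : Fin 2 => if i.val + j.val + 1 = 2 then (1 : L) else 0)).Local v ×
        (UnitaryGroup.cmDatum L 1 (Matrix.of fun i j : Fin 1 => if i.val + j.val + 1 = 1 then (1 : L) else 0)).Local v)]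
    [∀ v : HeightOneSpectrum (𝓞 ↥(maximalRealSubfield L)), BorelSpace ((UnitaryGroup.cmDatum L 2 (Matrix.of fun i j : Fin 2 => if i.val + j.val + 1 = 2 then (1 : L) else 0)).Local v ×
        (UnitaryGroup.cmDatum L 1 (Matrix.of fun i j : Fin 1 => if i.val + j.val + 1 = 1 then (1 : L) else 0)).Local v)]
    [∀ (v : HeightOneSpectrum (𝓞 ↥(maximalRealSubfield L))) (a : ((UnitaryGroup.cmDatum L 2 (Matrix.of fun i j : Fin 2 => if i.val + j.val + 1 = 2 then (1 : L) else 0)).Local v ×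
        (UnitaryGroup.cmDatum L 1 (Matrix.of fun i j : Fin 1 => if i.val + j.val + 1 = 1 then (1 : L) else 0)).Local v)),
      MeasurableSpace (((UnitaryGroup.cmDatum L 2 (Matrix.of fun i j : Fin 2 => if i.val + j.val + 1 = 2 then (1 : L) else 0)).Local v ×
        (UnitaryGroup.cmDatum L 1 (Matrix.of fun i j : Fin 1 => if i.val + j.val + 1 = 1 then (1 : L) else 0)).Local v) ⧸ Subgroup.centralizer ({a} : Set ((UnitaryGroup.cmDatum L 2 (Matrix.of fun i j : Fin 2 => if i.val + j.val + 1 = 2 then (1 : L) else 0)).Local v ×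
        (UnitaryGroup.cmDatum L 1 (Matrix.of fun i j : Fin 1 => if i.val + j.val + 1 = 1 then (1 : L) else 0)).Local v)))]
    [∀ (v : HeightOneSpectrum (𝓞 ↥(maximalRealSubfield L))) (a : ((UnitaryGroup.cmDatum L 2 (Matrix.of fun i j : Fin 2 => if i.val + j.val + 1 = 2 then (1 : L) else 0)).Local v ×
        (UnitaryGroup.cmDatum L 1 (Matrix.of fun i j : Fin 1 => if i.val + j.val + 1 = 1 then (1 : L) else 0)).Local v)),
      BorelSpace (((UnitaryGroup.cmDatum L 2 (Matrix.of fun i j : Fin 2 => if i.val + j.val + 1 = 2 then (1 : L) else 0)).Local v ×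
        (UnitaryGroup.cmDatum L 1 (Matrix.of fun i j : Fin 1 => if i.val + j.val + 1 = 1 then (1 : L) else 0)).Local v) ⧸ Subgroup.centralizer ({a} : Set ((UnitaryGroup.cmDatum L 2 (Matrix.of fun i j : Fin 2 => if i.val + j.val + 1 = 2 then (1 : L) else 0)).Local v ×
        (UnitaryGroup.cmDatum L 1 (Matrix.of fun i j : Fin 1 => if i.val + j.val + 1 = 1 then (1 : L) else 0)).Local v)))]
    [MeasurableSpace (UnitaryGroup.arch (↥(maximalRealSubfield L)) L (IsCMField.complexConj L) 3 (Matrix.of fun i j : Fin 3 => if i.val + j.val + 1 = 3 then (1 : L) else 0))] [BorelSpace (UnitaryGroup.arch (↥(maximalRealSubfield L)) L (IsCMField.complexConj L) 3 (Matrix.of fun i j : Fin 3 => if i.val + j.val + 1 = 3 then (1 : L) else 0))]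
    [∀ γ : UnitaryGroup.arch (↥(maximalRealSubfield L)) L (IsCMField.complexConj L) 3 (Matrix.of fun i j : Fin 3 => if i.val + j.val + 1 = 3 then (1 : L) else 0),
      MeasurableSpace (UnitaryGroup.arch (↥(maximalRealSubfield L)) L (IsCMField.complexConj L) 3 (Matrix.of fun i j : Fin 3 => if i.val + j.val + 1 = 3 then (1 : L) else 0) ⧸ Subgroup.centralizer ({γ} : Set (UnitaryGroup.arch (↥(maximalRealSubfield L)) L (IsCMField.complexConj L) 3 (Matrix.of fun i j : Fin 3 => if i.val + j.val + 1 = 3 then (1 : L) else 0))))]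
    [∀ γ : UnitaryGroup.arch (↥(maximalRealSubfield L)) L (IsCMField.complexConj L) 3 (Matrix.of fun i j : Fin 3 => if i.val + j.val + 1 = 3 then (1 : L) else 0),
      BorelSpace (UnitaryGroup.arch (↥(maximalRealSubfield L)) L (IsCMField.complexConj L) 3 (Matrix.of fun i j : Fin 3 => if i.val + j.val + 1 = 3 then (1 : L) else 0) ⧸ Subgroup.centralizer ({γ} : Set (UnitaryGroup.arch (↥(maximalRealSubfield L)) L (IsCMField.complexConj L) 3 (Matrix.of fun i j : Fin 3 => if i.val + j.val + 1 = 3 then (1 : L) else 0))))]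
    [MeasurableSpace (UnitaryGroup.arch (↥(maximalRealSubfield L)) L (IsCMField.complexConj L) 2 (Matrix.of fun i j : Fin 2 => if i.val + j.val + 1 = 2 then (1 : L) else 0) ×
          UnitaryGroup.arch (↥(maximalRealSubfield L)) L (IsCMField.complexConj L) 1 (Matrix.of fun i j : Fin 1 => if i.val + j.val + 1 = 1 then (1 : L) else 0))]
    [BorelSpace (UnitaryGroup.arch (↥(maximalRealSubfield L)) L (IsCMField.complexConj L) 2 (Matrix.of fun i j : Fin 2 => if i.val + j.val + 1 = 2 then (1 : L) else 0) ×
          UnitaryGroup.arch (↥(maximalRealSubfield L)) L (IsCMField.complexConj L) 1 (Matrix.of fun i j : Fin 1 => if i.val + j.val + 1 = 1 then (1 : L) else 0))]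
    [∀ a : (UnitaryGroup.arch (↥(maximalRealSubfield L)) L (IsCMField.complexConj L) 2 (Matrix.of fun i j : Fin 2 => if i.val + j.val + 1 = 2 then (1 : L) else 0) ×
          UnitaryGroup.arch (↥(maximalRealSubfield L)) L (IsCMField.complexConj L) 1 (Matrix.of fun i j : Fin 1 => if i.val + j.val + 1 = 1 then (1 : L) else 0)),
      MeasurableSpace ((UnitaryGroup.arch (↥(maximalRealSubfield L)) L (IsCMField.complexConj L) 2 (Matrix.of fun i j : Fin 2 => if i.val + j.val + 1 = 2 then (1 : L) else 0) ×
          UnitaryGroup.arch (↥(maximalRealSubfield L)) L (IsCMField.complexConj L) 1 (Matrix.of fun i j : Fin 1 => if i.val + j.val + 1 = 1 then (1 : L) else 0)) ⧸ Subgroup.centralizer ({a} : Set (UnitaryGroup.arch (↥(maximalRealSubfield L)) L (IsCMField.complexConj L) 2 (Matrix.of fun i j : Fin 2 => if i.val + j.val + 1 = 2 then (1 : L) else 0) ×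
          UnitaryGroup.arch (↥(maximalRealSubfield L)) L (IsCMField.complexConj L) 1 (Matrix.of fun i j : Fin 1 => if i.val + j.val + 1 = 1 then (1 : L) else 0))))]
    [∀ a : (UnitaryGroup.arch (↥(maximalRealSubfield L)) L (IsCMField.complexConj L) 2 (Matrix.of fun i j : Fin 2 => if i.val + j.val + 1 = 2 then (1 : L) else 0) ×
          UnitaryGroup.arch (↥(maximalRealSubfield L)) L (IsCMField.complexConj L) 1 (Matrix.of fun i j : Fin 1 => if i.val + j.val + 1 = 1 then (1 : L) else 0)),
      BorelSpace ((UnitaryGroup.arch (↥(maximalRealSubfield L)) L (IsCMField.complexConj L) 2 (Matrix.of fun i j : Fin 2 => if i.val + j.val + 1 = 2 then (1 : L) else 0) ×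
          UnitaryGroup.arch (↥(maximalRealSubfield L)) L (IsCMField.complexConj L) 1 (Matrix.of fun i j : Fin 1 => if i.val + j.val + 1 = 1 then (1 : L) else 0)) ⧸ Subgroup.centralizer ({a} : Set (UnitaryGroup.arch (↥(maximalRealSubfield L)) L (IsCMField.complexConj L) 2 (Matrix.of fun i j : Fin 2 => if i.val + j.val + 1 = 2 then (1 : L) else 0) ×
          UnitaryGroup.arch (↥(maximalRealSubfield L)) L (IsCMField.complexConj L) 1 (Matrix.of fun i j : Fin 1 => if i.val + j.val + 1 = 1 then (1 : L) else 0))))]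
    (νH : ∀ v : HeightOneSpectrum (𝓞 ↥(maximalRealSubfield L)), Measure ((UnitaryGroup.cmDatum L 2 (Matrix.of fun i j : Fin 2 => if i.val + j.val + 1 = 2 then (1 : L) else 0)).Local v ×
        (UnitaryGroup.cmDatum L 1 (Matrix.of fun i j : Fin 1 => if i.val + j.val + 1 = 1 then (1 : L) else 0)).Local v))
    (νG : ∀ v : HeightOneSpectrum (𝓞 ↥(maximalRealSubfield L)), Measure ((UnitaryGroup.cmDatum L 3 H').Local v))
    [∀ v, IsFiniteMeasureOnCompacts (νH v)] [∀ v, (νH v).IsMulRightInvariant]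
    [∀ v, (νG v).IsHaarMeasure] [∀ v, (νG v).IsMulRightInvariant]  -- MAIN-b's strength (F2): `νG_v` Haar
    (νGi : Measure (UnitaryGroup.arch (↥(maximalRealSubfield L)) L (IsCMField.complexConj L) 3 H')) (νqi : Measure (UnitaryGroup.arch (↥(maximalRealSubfield L)) L (IsCMField.complexConj L) 3 (Matrix.of fun i j : Fin 3 => if i.val + j.val + 1 = 3 then (1 : L) else 0)))
    (νHi : Measure (UnitaryGroup.arch (↥(maximalRealSubfield L)) L (IsCMField.complexConj L) 2 (Matrix.of fun i j : Fin 2 => if i.val + j.val + 1 = 2 then (1 : L) else 0) ×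
          UnitaryGroup.arch (↥(maximalRealSubfield L)) L (IsCMField.complexConj L) 1 (Matrix.of fun i j : Fin 1 => if i.val + j.val + 1 = 1 then (1 : L) else 0)))
    [IsFiniteMeasureOnCompacts νGi] [νGi.IsMulRightInvariant] [IsFiniteMeasureOnCompacts νqi] [νqi.IsMulRightInvariant]
    [IsFiniteMeasureOnCompacts νHi] [νHi.IsMulRightInvariant]

/-- **Socket #7 at ALMOST EVERY place, binders token for token.**  `S_bad` is finite and the rational `γ_H = (e₁·1₂, e₂)` is `v`-integral at all but finitely
many `v` (★ `eventually_toLocal_toAdelic_mem_cmLocalIntegralLevel` for `U(Φ₂)` and `U(Φ₁)`; `Φ_N` hermitian with unit determinant, ★ `antidiagOne_isHermitian`,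
★ `isUnit_antidiagOne_det`), so §1 applies along `Filter.cofinite` (fed by `hCTM`'s unit fundamental lemma off `S_bad`). [cite: Rogawski1990, §4.9 Prop. 4.9.1 (b) p. 55] [cite: PlatonovRapinchuk1994, §5.1] -/
theorem germConstantRegularH_eventually :
        ∀ (hK : ∀ v : HeightOneSpectrum (𝓞 ↥(maximalRealSubfield L)), νG v (UnitaryGroup.cmLocalIntegralLevel L 3 H' v : Set ((UnitaryGroup.cmDatum L 3 H').Local v)) = 1)
          (hanis : ∀ x : Fin 3 → L, hermForm (cmConjRingHom L) H' x x = 0 → x = 0)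
          (Sbad : Finset (HeightOneSpectrum (𝓞 ↥(maximalRealSubfield L))))
              (Δ : ∀ v : HeightOneSpectrum (𝓞 ↥(maximalRealSubfield L)), LocalTransferFactor L H' v)
              (mH : ∀ v : HeightOneSpectrum (𝓞 ↥(maximalRealSubfield L)),
                OrbitalMeasureFamily ((UnitaryGroup.cmDatum L 2 (Matrix.of fun i j : Fin 2 => if i.val + j.val + 1 = 2 then (1 : L) else 0)).Local v ×
                  (UnitaryGroup.cmDatum L 1 (Matrix.of fun i j : Fin 1 => if i.val + j.val + 1 = 1 then (1 : L) else 0)).Local v))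
              (mG : ∀ v : HeightOneSpectrum (𝓞 ↥(maximalRealSubfield L)), OrbitalMeasureFamily ((UnitaryGroup.cmDatum L 3 H').Local v))
          (m' : OrbitalMeasureFamily (UnitaryGroup.arch (↥(maximalRealSubfield L)) L (IsCMField.complexConj L) 3 H'))
                (m : OrbitalMeasureFamily (UnitaryGroup.arch (↥(maximalRealSubfield L)) L (IsCMField.complexConj L) 3
                  (Matrix.of fun i j : Fin 3 => if i.val + j.val + 1 = 3 then (1 : L) else 0)))
                (mHi : OrbitalMeasureFamily (UnitaryGroup.arch (↥(maximalRealSubfield L)) L (IsCMField.complexConj L) 2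
                    (Matrix.of fun i j : Fin 2 => if i.val + j.val + 1 = 2 then (1 : L) else 0) ×
                  UnitaryGroup.arch (↥(maximalRealSubfield L)) L (IsCMField.complexConj L) 1
                    (Matrix.of fun i j : Fin 1 => if i.val + j.val + 1 = 1 then (1 : L) else 0)))
                (t' : ∀ γ' : UnitaryGroup.arch (↥(maximalRealSubfield L)) L (IsCMField.complexConj L) 3 H',
                  Measure (Subgroup.centralizer ({γ'} : Set (UnitaryGroup.arch (↥(maximalRealSubfield L)) L (IsCMField.complexConj L) 3 H'))))
                (t : ∀ γ : UnitaryGroup.arch (↥(maximalRealSubfield L)) L (IsCMField.complexConj L) 3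
                    (Matrix.of fun i j : Fin 3 => if i.val + j.val + 1 = 3 then (1 : L) else 0),
                  Measure (Subgroup.centralizer ({γ} : Set (UnitaryGroup.arch (↥(maximalRealSubfield L)) L (IsCMField.complexConj L) 3
                    (Matrix.of fun i j : Fin 3 => if i.val + j.val + 1 = 3 then (1 : L) else 0)))))
                (tH : ∀ γH : UnitaryGroup.arch (↥(maximalRealSubfield L)) L (IsCMField.complexConj L) 2
                      (Matrix.of fun i j : Fin 2 => if i.val + j.val + 1 = 2 then (1 : L) else 0) ×
                    UnitaryGroup.arch (↥(maximalRealSubfield L)) L (IsCMField.complexConj L) 1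
                      (Matrix.of fun i j : Fin 1 => if i.val + j.val + 1 = 1 then (1 : L) else 0),
                  Measure (Subgroup.centralizer ({γH} : Set (UnitaryGroup.arch (↥(maximalRealSubfield L)) L (IsCMField.complexConj L) 2
                      (Matrix.of fun i j : Fin 2 => if i.val + j.val + 1 = 2 then (1 : L) else 0) ×
                    UnitaryGroup.arch (↥(maximalRealSubfield L)) L (IsCMField.complexConj L) 1
                      (Matrix.of fun i j : Fin 1 => if i.val + j.val + 1 = 1 then (1 : L) else 0)))))
            (hherm : (H'.map (cmConjRingHom L)).transpose = H')
            (hCTM : CanonicalTransferMatrix L H' Tinf.Δ νH νG Sbad Δ mH mG)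
            (hACS : ArchCanonicalSingularMatrix L H' Tinf νGi νqi νHi hanis m' m mHi t' t tH),
              ∀ (γ₀ : (UnitaryGroup.cmDatum L 3 H').Rational) (e₁ e₂ : L), e₁ ≠ e₂ →
                ((((γ₀ : unitaryGroup (cmConjRingHom L) H').val : GL (Fin 3) L) : Matrix (Fin 3) (Fin 3) L) - e₁ • (1 : Matrix (Fin 3) (Fin 3) L)) * ((((γ₀ : unitaryGroup (cmConjRingHom L) H').val : GL (Fin 3) L) : Matrix (Fin 3) (Fin 3) L) - e₂ • (1 : Matrix (Fin 3) (Fin 3) L)) = 0 →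
                (¬ ∃ ζ : L, (((γ₀ : unitaryGroup (cmConjRingHom L) H').val : GL (Fin 3) L) : Matrix (Fin 3) (Fin 3) L) = ζ • (1 : Matrix (Fin 3) (Fin 3) L)) →
                (((γ₀ : unitaryGroup (cmConjRingHom L) H').val : GL (Fin 3) L) : Matrix (Fin 3) (Fin 3) L).charpoly =
                  (Polynomial.X - Polynomial.C e₁) ^ 2 * (Polynomial.X - Polynomial.C e₂) →
                ∀ (γH : (UnitaryGroup.cmDatum L 2 (Matrix.of fun i j : Fin 2 => if i.val + j.val + 1 = 2 then (1 : L) else 0)).Rational ×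
                    (UnitaryGroup.cmDatum L 1 (Matrix.of fun i j : Fin 1 => if i.val + j.val + 1 = 1 then (1 : L) else 0)).Rational),
                  (((γH.1 : unitaryGroup (cmConjRingHom L) (Matrix.of fun i j : Fin 2 => if i.val + j.val + 1 = 2 then (1 : L) else 0)).val : GL (Fin 2) L) : Matrix (Fin 2) (Fin 2) L) =
                    e₁ • (1 : Matrix (Fin 2) (Fin 2) L) →
                  (((γH.2 : unitaryGroup (cmConjRingHom L) (Matrix.of fun i j : Fin 1 => if i.val + j.val + 1 = 1 then (1 : L) else 0)).val : GL (Fin 1) L) : Matrix (Fin 1) (Fin 1) L) 0 0 = e₂ →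
                  ∀ᶠ v : HeightOneSpectrum (𝓞 ↥(maximalRealSubfield L)) in Filter.cofinite,
                  ∃ (fH : (UnitaryGroup.cmDatum L 2 (Matrix.of fun i j : Fin 2 => if i.val + j.val + 1 = 2 then (1 : L) else 0)).Local v × (UnitaryGroup.cmDatum L 1 (Matrix.of fun i j : Fin 1 => if i.val + j.val + 1 = 1 then (1 : L) else 0)).Local v → ℂ) (f : (UnitaryGroup.cmDatum L 3 H').Local v → ℂ),
                    IsLocSmooth f ∧ IsLocSmooth fH ∧ IsLocalDeltaTransfer L H' v (Δ v) (mH v) (mG v) fH f ∧ fH ((UnitaryGroup.cmDatum L 2 (Matrix.of fun i j : Fin 2 => if i.val + j.val + 1 = 2 then (1 : L) else 0)).toLocal v ((UnitaryGroup.cmDatum L 2 (Matrix.of fun i j : Fin 2 => if i.val + j.val + 1 = 2 then (1 : L) else 0)).toAdelic γH.1),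
                            (UnitaryGroup.cmDatum L 1 (Matrix.of fun i j : Fin 1 => if i.val + j.val + 1 = 1 then (1 : L) else 0)).toLocal v ((UnitaryGroup.cmDatum L 1 (Matrix.of fun i j : Fin 1 => if i.val + j.val + 1 = 1 then (1 : L) else 0)).toAdelic γH.2)) ≠ 0 := by
  intro _ _ Sbad Δ mH mG _ _ _ _ _ _ _ hCTM _ _ _ _ _ _ _ _ γH _ _
  have hc : IsCMField.complexConj L ≠ 1 := IsCMField.complexConj_ne_one L
  have hH₂ : ((Matrix.of fun i j : Fin 2 => if i.val + j.val + 1 = 2 then (1 : L) else 0).map (IsCMField.complexConj L))ᵀ = (Matrix.of fun i j : Fin 2 => if i.val + j.val + 1 = 2 then (1 : L) else 0) := UnitaryGroup.antidiagOne_isHermitian L 2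
  have hH₁ : ((Matrix.of fun i j : Fin 1 => if i.val + j.val + 1 = 1 then (1 : L) else 0).map (IsCMField.complexConj L))ᵀ = (Matrix.of fun i j : Fin 1 => if i.val + j.val + 1 = 1 then (1 : L) else 0) := UnitaryGroup.antidiagOne_isHermitian L 1
  filter_upwards [Sbad.eventually_cofinite_notMem,
    UnitaryGroup.eventually_toLocal_toAdelic_mem_cmLocalIntegralLevel L 2 (Matrix.of fun i j : Fin 2 => if i.val + j.val + 1 = 2 then (1 : L) else 0) hc hH₂ (UnitaryGroup.isUnit_antidiagOne_det L 2).ne_zero γH.1,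
    UnitaryGroup.eventually_toLocal_toAdelic_mem_cmLocalIntegralLevel L 1 (Matrix.of fun i j : Fin 1 => if i.val + j.val + 1 = 1 then (1 : L) else 0) hc hH₁ (UnitaryGroup.isUnit_antidiagOne_det L 1).ne_zero γH.2] with v hv hz₁ hz₂
  exact exists_transferPair_apply_ne_zero_of_isLocalUnitTransfer L H' v ((hCTM.1 v).2.1 hv) _ (Subgroup.mem_prod.2 ⟨hz₁, hz₂⟩)

/-- **Socket #7 at EVERY NON-SPLIT GOOD place, binders token for token.**  At a place `v ∉ S_bad` with ONE place of `L` above it the point `γ_{H,v}` is integral outright: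
`γ_H.1 = e₁·1₂ ∈ U(Φ₂)(L)` forces `ē₁e₁ = 1` (§2), so `(γ_H.1)_v ∈ U(Φ₂)(𝒪_v)` (§2), and `U(Φ₁)(L⁺_v) = U(Φ₁)(𝒪_v)` (★ `cmLocalIntegralLevel_one_eq_top_of_smul_eq`);
hence the unit pair charges `γ_{H,v}`.  (These are exactly the places of STUB D of the tier-0 line; `S_bad` aside.)
[cite: Rogawski1990, §4.9 Prop. 4.9.1 (b) p. 55] [cite: PlatonovRapinchuk1994, §5.1] -/
theorem germConstantRegularH_of_subsingleton :
        ∀ (hK : ∀ v : HeightOneSpectrum (𝓞 ↥(maximalRealSubfield L)), νG v (UnitaryGroup.cmLocalIntegralLevel L 3 H' v : Set ((UnitaryGroup.cmDatum L 3 H').Local v)) = 1)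
          (hanis : ∀ x : Fin 3 → L, hermForm (cmConjRingHom L) H' x x = 0 → x = 0)
          (Sbad : Finset (HeightOneSpectrum (𝓞 ↥(maximalRealSubfield L))))
              (Δ : ∀ v : HeightOneSpectrum (𝓞 ↥(maximalRealSubfield L)), LocalTransferFactor L H' v)
              (mH : ∀ v : HeightOneSpectrum (𝓞 ↥(maximalRealSubfield L)),
                OrbitalMeasureFamily ((UnitaryGroup.cmDatum L 2 (Matrix.of fun i j : Fin 2 => if i.val + j.val + 1 = 2 then (1 : L) else 0)).Local v ×
                  (UnitaryGroup.cmDatum L 1 (Matrix.of fun i j : Fin 1 => if i.val + j.val + 1 = 1 then (1 : L) else 0)).Local v))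
              (mG : ∀ v : HeightOneSpectrum (𝓞 ↥(maximalRealSubfield L)), OrbitalMeasureFamily ((UnitaryGroup.cmDatum L 3 H').Local v))
          (m' : OrbitalMeasureFamily (UnitaryGroup.arch (↥(maximalRealSubfield L)) L (IsCMField.complexConj L) 3 H'))
                (m : OrbitalMeasureFamily (UnitaryGroup.arch (↥(maximalRealSubfield L)) L (IsCMField.complexConj L) 3
                  (Matrix.of fun i j : Fin 3 => if i.val + j.val + 1 = 3 then (1 : L) else 0)))
                (mHi : OrbitalMeasureFamily (UnitaryGroup.arch (↥(maximalRealSubfield L)) L (IsCMField.complexConj L) 2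
                    (Matrix.of fun i j : Fin 2 => if i.val + j.val + 1 = 2 then (1 : L) else 0) ×
                  UnitaryGroup.arch (↥(maximalRealSubfield L)) L (IsCMField.complexConj L) 1
                    (Matrix.of fun i j : Fin 1 => if i.val + j.val + 1 = 1 then (1 : L) else 0)))
                (t' : ∀ γ' : UnitaryGroup.arch (↥(maximalRealSubfield L)) L (IsCMField.complexConj L) 3 H',
                  Measure (Subgroup.centralizer ({γ'} : Set (UnitaryGroup.arch (↥(maximalRealSubfield L)) L (IsCMField.complexConj L) 3 H'))))
                (t : ∀ γ : UnitaryGroup.arch (↥(maximalRealSubfield L)) L (IsCMField.complexConj L) 3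
                    (Matrix.of fun i j : Fin 3 => if i.val + j.val + 1 = 3 then (1 : L) else 0),
                  Measure (Subgroup.centralizer ({γ} : Set (UnitaryGroup.arch (↥(maximalRealSubfield L)) L (IsCMField.complexConj L) 3
                    (Matrix.of fun i j : Fin 3 => if i.val + j.val + 1 = 3 then (1 : L) else 0)))))
                (tH : ∀ γH : UnitaryGroup.arch (↥(maximalRealSubfield L)) L (IsCMField.complexConj L) 2
                      (Matrix.of fun i j : Fin 2 => if i.val + j.val + 1 = 2 then (1 : L) else 0) ×
                    UnitaryGroup.arch (↥(maximalRealSubfield L)) L (IsCMField.complexConj L) 1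
                      (Matrix.of fun i j : Fin 1 => if i.val + j.val + 1 = 1 then (1 : L) else 0),
                  Measure (Subgroup.centralizer ({γH} : Set (UnitaryGroup.arch (↥(maximalRealSubfield L)) L (IsCMField.complexConj L) 2
                      (Matrix.of fun i j : Fin 2 => if i.val + j.val + 1 = 2 then (1 : L) else 0) ×
                    UnitaryGroup.arch (↥(maximalRealSubfield L)) L (IsCMField.complexConj L) 1
                      (Matrix.of fun i j : Fin 1 => if i.val + j.val + 1 = 1 then (1 : L) else 0)))))
            (hherm : (H'.map (cmConjRingHom L)).transpose = H')
            (hCTM : CanonicalTransferMatrix L H' Tinf.Δ νH νG Sbad Δ mH mG)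
            (hACS : ArchCanonicalSingularMatrix L H' Tinf νGi νqi νHi hanis m' m mHi t' t tH),
              ∀ (γ₀ : (UnitaryGroup.cmDatum L 3 H').Rational) (e₁ e₂ : L), e₁ ≠ e₂ →
                ((((γ₀ : unitaryGroup (cmConjRingHom L) H').val : GL (Fin 3) L) : Matrix (Fin 3) (Fin 3) L) - e₁ • (1 : Matrix (Fin 3) (Fin 3) L)) * ((((γ₀ : unitaryGroup (cmConjRingHom L) H').val : GL (Fin 3) L) : Matrix (Fin 3) (Fin 3) L) - e₂ • (1 : Matrix (Fin 3) (Fin 3) L)) = 0 →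
                (¬ ∃ ζ : L, (((γ₀ : unitaryGroup (cmConjRingHom L) H').val : GL (Fin 3) L) : Matrix (Fin 3) (Fin 3) L) = ζ • (1 : Matrix (Fin 3) (Fin 3) L)) →
                (((γ₀ : unitaryGroup (cmConjRingHom L) H').val : GL (Fin 3) L) : Matrix (Fin 3) (Fin 3) L).charpoly =
                  (Polynomial.X - Polynomial.C e₁) ^ 2 * (Polynomial.X - Polynomial.C e₂) →
                ∀ (γH : (UnitaryGroup.cmDatum L 2 (Matrix.of fun i j : Fin 2 => if i.val + j.val + 1 = 2 then (1 : L) else 0)).Rational ×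
                    (UnitaryGroup.cmDatum L 1 (Matrix.of fun i j : Fin 1 => if i.val + j.val + 1 = 1 then (1 : L) else 0)).Rational),
                  (((γH.1 : unitaryGroup (cmConjRingHom L) (Matrix.of fun i j : Fin 2 => if i.val + j.val + 1 = 2 then (1 : L) else 0)).val : GL (Fin 2) L) : Matrix (Fin 2) (Fin 2) L) =
                    e₁ • (1 : Matrix (Fin 2) (Fin 2) L) →
                  (((γH.2 : unitaryGroup (cmConjRingHom L) (Matrix.of fun i j : Fin 1 => if i.val + j.val + 1 = 1 then (1 : L) else 0)).val : GL (Fin 1) L) : Matrix (Fin 1) (Fin 1) L) 0 0 = e₂ →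
                  ∀ (v : HeightOneSpectrum (𝓞 ↥(maximalRealSubfield L))), v ∉ Sbad → Subsingleton (UnitaryGroup.PlacesOver L v) →
                  ∃ (fH : (UnitaryGroup.cmDatum L 2 (Matrix.of fun i j : Fin 2 => if i.val + j.val + 1 = 2 then (1 : L) else 0)).Local v × (UnitaryGroup.cmDatum L 1 (Matrix.of fun i j : Fin 1 => if i.val + j.val + 1 = 1 then (1 : L) else 0)).Local v → ℂ) (f : (UnitaryGroup.cmDatum L 3 H').Local v → ℂ),
                    IsLocSmooth f ∧ IsLocSmooth fH ∧ IsLocalDeltaTransfer L H' v (Δ v) (mH v) (mG v) fH f ∧ fH ((UnitaryGroup.cmDatum L 2 (Matrix.of fun i j : Fin 2 => if i.val + j.val + 1 = 2 then (1 : L) else 0)).toLocal v ((UnitaryGroup.cmDatum L 2 (Matrix.of fun i j : Fin 2 => if i.val + j.val + 1 = 2 then (1 : L) else 0)).toAdelic γH.1),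
                            (UnitaryGroup.cmDatum L 1 (Matrix.of fun i j : Fin 1 => if i.val + j.val + 1 = 1 then (1 : L) else 0)).toLocal v ((UnitaryGroup.cmDatum L 1 (Matrix.of fun i j : Fin 1 => if i.val + j.val + 1 = 1 then (1 : L) else 0)).toAdelic γH.2)) ≠ 0 := by
  intro _ _ Sbad Δ mH mG _ _ _ _ _ _ _ hCTM _ _ e₁ _ _ _ _ _ γH hγH₁ _ v hv hsub
  obtain ⟨w⟩ := UnitaryGroup.PlacesOver.nonempty L v
  have hw : IsCMField.complexConj L • w.1 = w.1 := smul_placesOver_eq_of_subsingleton L v (IsCMField.complexConj L) hsub w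
  have he₁ : cmConjRingHom L e₁ * e₁ = 1 :=
    cmConj_mul_self_eq_one_of_coe_eq_smul_one L (0 : Fin 2) (1 : Fin 2) (by simp) hγH₁
  have hz₁ := toLocal_toAdelic_mem_cmLocalIntegralLevel_of_coe_eq_smul_one L v hsub hγH₁ he₁
  have hz₂ : (UnitaryGroup.cmDatum L 1 (Matrix.of fun i j : Fin 1 => if i.val + j.val + 1 = 1 then (1 : L) else 0)).toLocal v ((UnitaryGroup.cmDatum L 1 (Matrix.of fun i j : Fin 1 => if i.val + j.val + 1 = 1 then (1 : L) else 0)).toAdelic γH.2) ∈ UnitaryGroup.cmLocalIntegralLevel L 1 (Matrix.of fun i j : Fin 1 => if i.val + j.val + 1 = 1 then (1 : L) else 0) v := by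
    rw [UnitaryGroup.cmLocalIntegralLevel_one_eq_top_of_smul_eq L (Matrix.of fun i j : Fin 1 => if i.val + j.val + 1 = 1 then (1 : L) else 0) w hw (UnitaryGroup.isUnit_placeForm_antidiagOne (E := L) 1 w.1)]
    exact Subgroup.mem_top _
  exact exists_transferPair_apply_ne_zero_of_isLocalUnitTransfer L H' v ((hCTM.1 v).2.1 hv) _ (Subgroup.mem_prod.2 ⟨hz₁, hz₂⟩)

end Frame

end Summit.HodgeConjecture.HodgeConjecture.Cruxes.H413.K2E3GermConstantRegularHUnitPair

end
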